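import Literature.AlgebraicGeometry.HodgeTheory.HomComplexQuasiIso
import Literature.AlgebraicGeometry.HodgeTheory.HomComplexUnit
import Literature.AlgebraicGeometry.HodgeTheory.DerivedDescent
import Literature.AlgebraicGeometry.HodgeTheory.HomComplexSupertrace
import Literature.AlgebraicGeometry.HodgeTheory.ComplexAtiyahClass
import Literature.AlgebraicGeometry.HodgeTheory.ComplexAtiyahPower
import Mathlib.Algebra.Homology.BifunctorShift
import HarnessLib

/-!
# The semiregularity map `σ_q` of a bounded complex of vector bundles, on real carriers

PROMOTED LITERATURE COPY (librarian protocol (b); DEFREQ-CoherentISemiregular, cell pub-hsemireg) of the generic, conjecture-free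
`Summits/Ventures/HSemireg/HomComplexSigma.lean` — namespace now `Literature.AlgebraicGeometry.HodgeTheory`, names kept; cell words (seats, ventures) = provenance.

For `X` a scheme over `Spec S`, `K•` a cochain complex of `𝒪_X`-modules concentrated in `[a, b]` with every `K^p` finite
locally free (a strictly perfect complex), `q : ℕ` and `x ∈ Ext²(K•, K•) = Hom_{D(X)}(Q K•, (Q K•)⟦2⟧)`, we DEFINE

  `σ_q(x) := Q(unit) ≫ Φ_K(x · ι• · At(K•)^q) ≫ Q(Tr•)⟦q+2⟧ : Q 𝒪_X[0] ⟶ (Q Ωᵍ_X[0])⟦q+2⟧`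

(`HomComplex.sigmaC`), its `Ext`-typed form `sigmaExt : Ext^{q+2}(𝒪_X, Ω^q)` (Mathlib `Ext.homEquiv`) and its image
`sigmaCoh ∈ H^{q+2}(X, Ω^q)` under the tree's comparison `extToCohomology`; `IsSemiregularC` := injectivity of `σ_q`,
`IsISemiregularC I` := joint injectivity of `(σ_q)_{q ∈ I}` (BF §5's `I`-semiregularity, for complexes).
§2 proves that `σ_q` is ADDITIVE (`sigmaC_add`; via additivity of the descended functor `derivedLift Φ` of an additive `Φ` —
`derivedLift_additive`, Mathlib `Localization.functor_additive_iff` along `Qh` — and of `𝓗om•(K•, –)`), packages it as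
`sigmaCHom : Ext²(K•,K•) →+ Hom_D(Q 𝒪_X[0], (Q Ω^q[0])⟦q+2⟧)`, and gives `I`-semiregularity its joint-KERNEL form
(`isISemiregularC_iff_ker`, the shape of the tree's module-level `IsISemiregular`).
Ingredients, all landed: the internal Hom complex `𝓗om•(K•, –)` (`HomComplex*.lean`: an endofunctor of cochain complexes commuting
with shifts which preserves quasi-isomorphisms for `K•` strictly perfect), its descent `Φ_K` to the derived category and the action
on shifted Homs (`DerivedDescent.lean`, seat p3), the unit `𝒪_X[0] ⟶ 𝓗om•(K•, K•)` (`HomComplexUnit.lean`), the supertrace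
`Tr• : 𝓗om•(K•, K• ⊗ G) ⟶ G[0]` (`HomComplexSupertrace.lean`, seat p3), and `x ↦ x · ι• · At(K•)^q` (`ComplexAtiyahClass.lean`,
seats p3/gs-g4).  KERNEL NOTE: `K• ⊗ Ω^q` has two definitionally equal spellings (`twistHodgeComplex X q K` of the Atiyah files and
`twistG X.left (hodgeSheaf X q) K` of the supertrace); the kernel exhausts memory comparing the two internal-Hom BICOMPLEXES, so
the supertrace is transported along the `def`-hidden `Iso.refl` `twistHodgeIsoG` (`supertraceH`) — mathematically the identity.
Signs/factorials of [BF03, Def. 4.1] are NOT inserted (they do not affect injectivity).  Nothing here is a claim about any conjecture.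
[cite: BuchweitzFlenner2003, Def. 4.1 and §4]
-/

noncomputable section

open CategoryTheory CategoryTheory.Limits AlgebraicGeometry

namespace Literature.AlgebraicGeometry.HodgeTheory

open Literature.AlgebraicGeometry.Modules Literature.AlgebraicGeometry.Motives

namespace HomComplex

section Sigma

universe w₁ u₁

variable {S : Type u₁} [CommRing S] (X : Over (Spec (CommRingCat.of S))) [HasDerivedCategory.{w₁} X.left.Modules]
  (K : CochainComplex X.left.Modules ℤ)

/-- `𝓗om•(E•, –)` as an endofunctor of cochain complexes (Mathlib `Functor.map₂CochainComplex` of the internal-Hom bifunctor,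
first variable fixed to the dual complex); on objects `homComplex X E F`, on morphisms `HomComplex.map X E φ` (definitionally).
[cite: BuchweitzFlenner2003, §4] -/
abbrev homFunctor (Y : Scheme.{w₁}) (E : CochainComplex Y.Modules ℤ) :
    CochainComplex Y.Modules ℤ ⥤ CochainComplex Y.Modules ℤ :=
  ((sheafHomBifunctor Y).flip.map₂CochainComplex).flip.obj (dualComplex Y E)

/-- `𝓗om•(E•, –)` commutes with shifts (Mathlib `BifunctorShift`, first-variable shift; sign-free). [folklore] -/
instance homFunctor_commShift (Y : Scheme.{w₁}) (E : CochainComplex Y.Modules ℤ) : (homFunctor Y E).CommShift ℤ :=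
  inferInstance

omit [HasDerivedCategory X.left.Modules] in
/-- `𝓗om•(K•, –)` sends quasi-isomorphisms to quasi-isomorphisms for `K• ∈ [a, b]` termwise finite locally free
(`HomComplex.quasiIso_map_of_bounded`). [cite: Hartshorne1977, III.6 (proof of Prop. 6.5)] -/
theorem homFunctor_map_quasiIso (a b : ℤ) [K.IsStrictlyGE a] [K.IsStrictlyLE b] (hK : ∀ p, IsFiniteLocallyFree (K.X p)) :
    ∀ ⦃L L' : CochainComplex X.left.Modules ℤ⦄ (f : L ⟶ L'), QuasiIso f → QuasiIso ((homFunctor X.left K).map f) :=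
  fun _ _ f hf => by haveI := hf; exact quasiIso_map_of_bounded X.left f K a b hK

/-- Hence `𝓗om•(K•, –) ⋙ Q` inverts quasi-isomorphisms (the hypothesis of `derivedLift`).
[cite: Weibel1994, Def. 10.3.1 and Cor. 10.4.7 (localisation at quasi-isomorphisms)] -/
theorem homFunctor_isInvertedBy (a b : ℤ) [K.IsStrictlyGE a] [K.IsStrictlyLE b] (hK : ∀ p, IsFiniteLocallyFree (K.X p)) :
    (HomologicalComplex.quasiIso X.left.Modules (ComplexShape.up ℤ)).IsInvertedBy (homFunctor X.left K ⋙ DerivedCategory.Q) :=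
  isInvertedBy_of_map_quasiIso (homFunctor_map_quasiIso X K a b hK)

/-- The unit `Q(𝒪_X[0]) ⟶ Q(𝓗om•(K•, K•))` (`HomComplex.unit` retyped onto `homFunctor`, definitionally). [folklore] -/
def unitQ (a b : ℤ) [K.IsStrictlyGE a] [K.IsStrictlyLE b] :
    DerivedCategory.Q.obj ((HomologicalComplex.single X.left.Modules (ComplexShape.up ℤ) 0).obj (unitModule X.left)) ⟶
      DerivedCategory.Q.obj ((homFunctor X.left K).obj K) :=
  DerivedCategory.Q.map (unit X.left K a b)

/-- `K• ⊗ Ω^q` in its two definitional spellings (`twistHodgeComplex` of the Atiyah files vs the supertrace's `twistG`),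
identified by `Iso.refl` behind a `def` (see the module docstring: the kernel must never compare the two Hom bicomplexes). [folklore] -/
def twistHodgeIsoG (q : ℕ) : twistHodgeComplex X q K ≅ twistG X.left (hodgeSheaf X q) K := Iso.refl _

/-- The supertrace as a morphism out of `𝓗om•(K•, K• ⊗ Ω^q)` in the `homFunctor`/`twistHodgeComplex` spelling
(transport of `HomComplex.supertrace` along `twistHodgeIsoG`). [cite: BuchweitzFlenner2003, §4 (trace map)] -/
def supertraceH (hK : ∀ p, IsFiniteLocallyFree (K.X p)) (q : ℕ) :
    (homFunctor X.left K).obj (twistHodgeComplex X q K) ⟶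
      (HomologicalComplex.single X.left.Modules (ComplexShape.up ℤ) 0).obj (hodgeSheaf X q) :=
  (homFunctor X.left K).map (twistHodgeIsoG X K q).hom ≫ supertrace X.left (hodgeSheaf X q) K hK

/-- `Φ_K(x · ι• · At(K•)^q) : Q 𝓗om•(K•,K•) ⟶ (Q 𝓗om•(K•, K• ⊗ Ω^q))⟦q+2⟧` — the descended internal-Hom functor
(`derivedLift`/`shiftedHomMap`) applied to the tree's `extMulAtiyahPower`. [cite: BuchweitzFlenner2003, Def. 4.1] -/
def phiMulAtiyahPower (a b : ℤ) [K.IsStrictlyGE a] [K.IsStrictlyLE b] (hK : ∀ p, IsFiniteLocallyFree (K.X p))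
    (q : ℕ) (x : ShiftedHom (DerivedCategory.Q.obj K) (DerivedCategory.Q.obj K) (2 : ℤ)) :
    ShiftedHom (DerivedCategory.Q.obj ((homFunctor X.left K).obj K))
      (DerivedCategory.Q.obj ((homFunctor X.left K).obj (twistHodgeComplex X q K))) ((q : ℤ) + 2) :=
  shiftedHomMap (homFunctor X.left K) (homFunctor_isInvertedBy X K a b hK) (extMulAtiyahPower X K q x)

/-- **`σ_q` of a bounded complex of finite locally free `𝒪_X`-modules**, on real carriers:
`x ∈ Hom_D(Q K•, (Q K•)⟦2⟧) ↦ Q(unit) ≫ Φ_K(x · ι• · At(K•)^q) ≫ Q(Tr•)⟦q+2⟧ ∈ Hom_D(Q 𝒪_X[0], (Q Ω^q_X[0])⟦q+2⟧)`.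
The degree is typed `((q + 2 : ℕ) : ℤ)` so that Mathlib's `Ext.homEquiv` applies with no cast. Signs/factorials of BF Def. 4.1
not inserted. [cite: BuchweitzFlenner2003, Def. 4.1] -/
def sigmaC (a b : ℤ) [K.IsStrictlyGE a] [K.IsStrictlyLE b] (hK : ∀ p, IsFiniteLocallyFree (K.X p))
    (q : ℕ) (x : ShiftedHom (DerivedCategory.Q.obj K) (DerivedCategory.Q.obj K) (2 : ℤ)) :
    ShiftedHom (DerivedCategory.Q.obj ((HomologicalComplex.single X.left.Modules (ComplexShape.up ℤ) 0).obj (unitModule X.left)))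
      (DerivedCategory.Q.obj ((HomologicalComplex.single X.left.Modules (ComplexShape.up ℤ) 0).obj (hodgeSheaf X q)))
      ((q + 2 : ℕ) : ℤ) :=
  ((ShiftedHom.mk₀ (0 : ℤ) rfl (unitQ X K a b)).comp (phiMulAtiyahPower X K a b hK q x) (add_zero _)).comp
    (ShiftedHom.mk₀ (0 : ℤ) rfl (DerivedCategory.Q.map (supertraceH X K hK q))) (by omega)

/-- `σ_q(x)` as an element of the (large) `Ext^{q+2}(𝒪_X, Ω^q_X)` via Mathlib's `Ext.homEquiv`
(`Q (A[0]) = (singleFunctor _ 0).obj A` definitionally). [cite: BuchweitzFlenner2003, Def. 4.1] -/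
def sigmaExt (a b : ℤ) [K.IsStrictlyGE a] [K.IsStrictlyLE b] (hK : ∀ p, IsFiniteLocallyFree (K.X p))
    (q : ℕ) (x : ShiftedHom (DerivedCategory.Q.obj K) (DerivedCategory.Q.obj K) (2 : ℤ)) :
    Abelian.Ext (unitModule X.left) (hodgeSheaf X q) (q + 2) :=
  Abelian.Ext.homEquiv.symm (sigmaC X K a b hK q x)

/-- `σ_q(x) ∈ H^{q+2}(X, Ω^q_X)`: the `Ext` class pushed through the tree's comparison `extToCohomology` (Hartshorne III.6.3 (c));
`hodgeCohomology X q (q + 2)` is that group by definition. [cite: Hartshorne1977, III.6.3 (c)] -/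
def sigmaCoh (a b : ℤ) [K.IsStrictlyGE a] [K.IsStrictlyLE b] (hK : ∀ p, IsFiniteLocallyFree (K.X p))
    (q : ℕ) (x : ShiftedHom (DerivedCategory.Q.obj K) (DerivedCategory.Q.obj K) (2 : ℤ)) :
    hodgeCohomology X q (q + 2) :=
  Literature.AlgebraicGeometry.HodgeTheory.extToCohomology (hodgeSheaf X q) (q + 2) (sigmaExt X K a b hK q x)

/-- **`q`-semiregularity of a strictly perfect complex** (PREDICATE, nothing asserted): `σ_q` is injective on
`Ext²(K•, K•) = Hom_D(Q K•, (Q K•)⟦2⟧)`. [cite: BuchweitzFlenner2003, Def. 4.1 and Introduction] -/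
def IsSemiregularC (a b : ℤ) [K.IsStrictlyGE a] [K.IsStrictlyLE b] (hK : ∀ p, IsFiniteLocallyFree (K.X p)) (q : ℕ) : Prop :=
  Function.Injective (sigmaC X K a b hK q)

/-- **`I`-semiregularity of a strictly perfect complex** for a set `I` of form degrees (PREDICATE, nothing asserted):
the part `(σ_q)_{q ∈ I}` of the semiregularity map is JOINTLY injective on `Ext²(K•, K•)` — the complex analogue of
the tree's `IsISemiregular` for a finite locally free sheaf («`ℰ₀` is called `I`-semiregular if the part `σ_I` of the
semiregularity map is injective», BF §5), phrased as injectivity of `x ↦ (σ_q(x))_{q ∈ I}` so that no additivity of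
`σ_q` is presupposed. [cite: BuchweitzFlenner2003, §5 (I-semiregular) and Def. 4.1] -/
def IsISemiregularC (a b : ℤ) [K.IsStrictlyGE a] [K.IsStrictlyLE b] (hK : ∀ p, IsFiniteLocallyFree (K.X p))
    (I : Set ℕ) : Prop :=
  Function.Injective fun (x : ShiftedHom (DerivedCategory.Q.obj K) (DerivedCategory.Q.obj K) (2 : ℤ)) (q : I) =>
    sigmaC X K a b hK q x

/-- `q`-semiregular is `{q}`-semiregular. [cite: BuchweitzFlenner2003, §5] -/
theorem isSemiregularC_iff_isISemiregularC_singleton (a b : ℤ) [K.IsStrictlyGE a] [K.IsStrictlyLE b]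
    (hK : ∀ p, IsFiniteLocallyFree (K.X p)) (q : ℕ) :
    IsSemiregularC X K a b hK q ↔ IsISemiregularC X K a b hK {q} := by
  constructor
  · intro h x y hxy
    exact h (congr_fun hxy ⟨q, rfl⟩)
  · intro h x y hxy
    refine h (funext fun q' => ?_)
    obtain ⟨q', rfl⟩ := q'
    exact hxy

/-- `I`-semiregularity is monotone in `I`: more components can only help injectivity. [cite: BuchweitzFlenner2003, §5] -/
theorem IsISemiregularC.mono {a b : ℤ} [K.IsStrictlyGE a] [K.IsStrictlyLE b] {hK : ∀ p, IsFiniteLocallyFree (K.X p)}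
    {I J : Set ℕ} (hIJ : I ⊆ J) (h : IsISemiregularC X K a b hK I) : IsISemiregularC X K a b hK J :=
  fun _ _ hxy => h (funext fun q => congr_fun hxy ⟨q.1, hIJ q.2⟩)

end Sigma

end HomComplex

/-! ## §2 Additivity of `σ_q` and the joint-kernel form of `I`-semiregularity -/

section DerivedLiftAdditive

universe w v u

variable {C : Type u} [Category.{v} C] [Abelian C] [HasDerivedCategory.{w} C]
  (Φ : CochainComplex C ℤ ⥤ CochainComplex C ℤ) [Φ.Additive]
  (hΦ : (HomologicalComplex.quasiIso C (ComplexShape.up ℤ)).IsInvertedBy (Φ ⋙ DerivedCategory.Q))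

/-- **The descended functor of an additive endofunctor of cochain complexes is additive.**  `Q ⋙ derivedLift Φ ≅ Φ ⋙ Q`
is additive; `Q ≅ quotient ⋙ Qh` with the homotopy quotient full and essentially surjective, so `Qh ⋙ derivedLift Φ` is
additive; and additivity descends along the localization `Qh` (left calculus of fractions for the acyclic subcategory,
Mathlib `Localization.functor_additive_iff`). [cite: Weibel1994, Def. 10.3.1 and Cor. 10.4.7 (localisation at quasi-isomorphisms)] -/
theorem derivedLift_additive : (derivedLift Φ hΦ).Additive := by
  have h1 : (DerivedCategory.Q ⋙ derivedLift Φ hΦ).Additive := Functor.additive_of_iso (derivedLiftFac Φ hΦ).symm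
  have h2 : (HomotopyCategory.quotient C (ComplexShape.up ℤ) ⋙
      (DerivedCategory.Qh ⋙ derivedLift Φ hΦ)).Additive :=
    Functor.additive_of_iso ((Functor.isoWhiskerRight (DerivedCategory.quotientCompQhIso C) (derivedLift Φ hΦ)).symm
      ≪≫ Functor.associator _ _ _)
  have h3 : (DerivedCategory.Qh ⋙ derivedLift Φ hΦ).Additive :=
    Functor.additive_of_full_essSurj_comp (HomotopyCategory.quotient C (ComplexShape.up ℤ)) _
  exact (Localization.functor_additive_iff DerivedCategory.Qh
    (HomotopyCategory.subcategoryAcyclic C).trW (derivedLift Φ hΦ)).2 h3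

/-- `Φ_*` on shifted Homs is additive for `Φ` additive. [cite: Weibel1994, Def. 10.3.1 and Cor. 10.4.7 (localisation at quasi-isomorphisms)] -/
theorem shiftedHomMap_add [Φ.CommShift ℤ] {K L : CochainComplex C ℤ} {n : ℤ}
    (x y : ShiftedHom (DerivedCategory.Q.obj K) (DerivedCategory.Q.obj L) n) :
    shiftedHomMap Φ hΦ (x + y) = shiftedHomMap Φ hΦ x + shiftedHomMap Φ hΦ y := by
  haveI := derivedLift_additive Φ hΦ
  have e : ∀ z : ShiftedHom (DerivedCategory.Q.obj K) (DerivedCategory.Q.obj L) n, shiftedHomMap Φ hΦ z =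
      ((ShiftedHom.mk₀ (X := DerivedCategory.Q.obj (Φ.obj K)) (Y := (derivedLift Φ hΦ).obj (DerivedCategory.Q.obj K))
          (0 : ℤ) rfl ((derivedLiftFac Φ hΦ).inv.app K)).comp (z.map (derivedLift Φ hΦ)) (add_zero n)).comp
        (ShiftedHom.mk₀ (X := (derivedLift Φ hΦ).obj (DerivedCategory.Q.obj L)) (Y := DerivedCategory.Q.obj (Φ.obj L))
          (0 : ℤ) rfl ((derivedLiftFac Φ hΦ).hom.app L)) (zero_add n) :=
    fun z => by
    rw [ShiftedHom.comp_mk₀, ShiftedHom.mk₀_comp, Category.assoc]; rfl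
  rw [e, e, e, ShiftedHom.map_add, ShiftedHom.comp_add, ShiftedHom.add_comp]

end DerivedLiftAdditive

namespace HomComplex

section SigmaAdditive

universe w₁ u₁

variable {S : Type u₁} [CommRing S] (X : Over (Spec (CommRingCat.of S))) [HasDerivedCategory.{w₁} X.left.Modules]
  (K : CochainComplex X.left.Modules ℤ)

omit [HasDerivedCategory X.left.Modules] in
/-- `𝓗om•(E•, –)` is an additive endofunctor of cochain complexes (termwise: `𝓗om(E^p, –)` is additive). [cite: Hartshorne1977, II §5 (sheaf Hom, p. 109)] -/
theorem homFunctor_additive (Y : Scheme.{w₁}) (E : CochainComplex Y.Modules ℤ) : (homFunctor Y E).Additive := by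
  refine ⟨fun {F F'} {φ ψ} => ?_⟩
  change HomComplex.map Y E (φ + ψ) = HomComplex.map Y E φ + HomComplex.map Y E ψ
  refine HomologicalComplex.hom_ext _ _ fun n => HomologicalComplex.mapBifunctor.hom_ext fun q i h => ?_
  change ι Y E F q i n h ≫ _ = ι Y E F q i n h ≫ _
  rw [ι_map, HomologicalComplex.add_f_apply, HomologicalComplex.add_f_apply, Preadditive.comp_add, ι_map, ι_map,
    sheafHomMap_add, Preadditive.add_comp]

/-- **`σ_q` is additive**: `σ_q(x + y) = σ_q(x) + σ_q(y)`. [cite: BuchweitzFlenner2003, Def. 4.1] -/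
theorem sigmaC_add (a b : ℤ) [K.IsStrictlyGE a] [K.IsStrictlyLE b] (hK : ∀ p, IsFiniteLocallyFree (K.X p)) (q : ℕ)
    (x y : ShiftedHom (DerivedCategory.Q.obj K) (DerivedCategory.Q.obj K) (2 : ℤ)) :
    sigmaC X K a b hK q (x + y) = sigmaC X K a b hK q x + sigmaC X K a b hK q y := by
  haveI := homFunctor_additive X.left K
  simp only [sigmaC, phiMulAtiyahPower, extMulAtiyahPower_eq_comp, ShiftedHom.add_comp, shiftedHomMap_add,
    ShiftedHom.comp_add]

/-- `σ_q(0) = 0`. [cite: BuchweitzFlenner2003, Def. 4.1] -/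
theorem sigmaC_zero (a b : ℤ) [K.IsStrictlyGE a] [K.IsStrictlyLE b] (hK : ∀ p, IsFiniteLocallyFree (K.X p)) (q : ℕ) :
    sigmaC X K a b hK q 0 = 0 := by
  have h := sigmaC_add X K a b hK q 0 0
  rw [add_zero] at h
  exact left_eq_add.mp h

/-- `σ_q` as an additive homomorphism `Ext²(K•, K•) →+ Hom_D(Q 𝒪_X[0], (Q Ω^q[0])⟦q+2⟧)`. [cite: BuchweitzFlenner2003, Def. 4.1] -/
def sigmaCHom (a b : ℤ) [K.IsStrictlyGE a] [K.IsStrictlyLE b] (hK : ∀ p, IsFiniteLocallyFree (K.X p)) (q : ℕ) :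
    ShiftedHom (DerivedCategory.Q.obj K) (DerivedCategory.Q.obj K) (2 : ℤ) →+
      ShiftedHom (DerivedCategory.Q.obj ((HomologicalComplex.single X.left.Modules (ComplexShape.up ℤ) 0).obj
          (unitModule X.left)))
        (DerivedCategory.Q.obj ((HomologicalComplex.single X.left.Modules (ComplexShape.up ℤ) 0).obj (hodgeSheaf X q)))
        ((q + 2 : ℕ) : ℤ) where
  toFun := sigmaC X K a b hK q
  map_zero' := sigmaC_zero X K a b hK q
  map_add' := sigmaC_add X K a b hK q

/-- **`I`-semiregularity as a joint-kernel condition** (the shape of the tree's module-level `IsISemiregular`): `(σ_q)_{q ∈ I}`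
is jointly injective iff `σ_q(x) = 0` for all `q ∈ I` forces `x = 0`. [cite: BuchweitzFlenner2003, §5 (I-semiregular)] -/
theorem isISemiregularC_iff_ker (a b : ℤ) [K.IsStrictlyGE a] [K.IsStrictlyLE b] (hK : ∀ p, IsFiniteLocallyFree (K.X p))
    (I : Set ℕ) :
    IsISemiregularC X K a b hK I ↔
      ∀ x : ShiftedHom (DerivedCategory.Q.obj K) (DerivedCategory.Q.obj K) (2 : ℤ),
        (∀ q ∈ I, sigmaC X K a b hK q x = 0) → x = 0 := by
  constructor
  · intro h x hx
    refine h (funext fun q => ?_)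
    change sigmaC X K a b hK q x = sigmaC X K a b hK q 0
    rw [hx q.1 q.2, sigmaC_zero]
  · intro h x y hxy
    refine sub_eq_zero.mp (h _ fun q hq => ?_)
    have hq' : sigmaC X K a b hK q x = sigmaC X K a b hK q y := congr_fun hxy ⟨q, hq⟩
    change sigmaCHom X K a b hK q (x - y) = 0
    rw [map_sub, sub_eq_zero]
    exact hq'

end SigmaAdditive

end HomComplex

end Literature.AlgebraicGeometry.HodgeTheory

end
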